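import Literature.Claims.NS.Nguyen2022
import HarnessLib

/-!
# Solo salvage for claim C75 `Nguyen2022` (cell `ns-claims`, D-0090): TRUE steps of the typed skeleton, kernel-discharged

Claim: V. T. Nguyen, arXiv:2004.08239 v8 (text of record), Thm 1.0.1 p. 2 (global smooth solutions on
`ℝ³ × [0,∞)` for data in the closure of `C^∞_{c,σ}` in every `H^m`), resting on Thm 3.0.1 p. 17 («E′ = −C₀Z,
Z′ ≤ C₁Z³ ⇒ E + Z non-increasing»). Skeleton `Literature.Claims.NS.Nguyen2022` (typist-9, p467749). This
SALVAGE file (seat `ns-claims-salvage-p4`, solo lane, no item) records in the kernel the step that is TRUE: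

* `step3_mConst_holds : Step3_LambdaLimit_mConst` — the typist's CHARITABLE TWIN of the λ → 0 passage on
  p. 19 (if the constant `m > 0` does not depend on `λ`, then `(λ + m/Z₁)/(λ + m/Z) ≤ r` for all
  `λ ∈ (0,1)` gives `Z/Z₁ ≤ r` in the limit): elementary continuity at `λ = 0`. So the charitable reading
  SURVIVES AS A LEMMA and the break sits where the typist/referee locate it (the printed `m` of (3.0.6)
  scales with `λ`, `Step3_LambdaLimit` / `Step2_RescaledInequality`), adjudicated by refuter-5 — not here.
* The classical ingredients around Thm 3.0.1 (energy identity, enstrophy inequality `Z′ ≤ C₁Z³`, Galerkin /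
  Aubin–Lions, H¹ local theory) are tree facts (`IsClassicalNSSolutionOn.energyEq_Ioo`, `EnstrophyGronwall*`,
  `TaoH1APriori*`, `NSGalerkin*`, `leray_local_regular_H1_holds`) and are cited, not re-derived.

WHAT THIS IS NOT: not a claim about NS regularity or blow-up; not a claim about any author beyond the typed locator.
-/

set_option linter.dupNamespace false

noncomputable section

namespace Summit.NavierStokesRegularity.NavierStokesRegularity.Theorems.Nguyen2022

open Set Filter
open scoped Topology
open Literature.Claims.NS.Nguyen2022

/-- **The λ-constant reading of the limit passage p. 19 holds** (`Step3_LambdaLimit_mConst`): for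
`Z₁, Z, m > 0`, if `(λ + m/Z₁)/(λ + m/Z) ≤ r` for every `λ ∈ (0,1)` then `Z/Z₁ ≤ r` — the quotient is
continuous at `λ = 0` with value `(m/Z₁)/(m/Z) = Z/Z₁`. [cite: Nguyen2022NSGlobalNoForce, proof of Thm 3.0.1 Step 2, «Passing to the limit as λ → 0», p. 19] -/
theorem step3_mConst_holds : Step3_LambdaLimit_mConst := by
  intro Z₁ Z m r hZ₁ hZ hm h
  have hc : (0 : ℝ) + m / Z ≠ 0 := by positivity
  have hlim : Tendsto (fun lam : ℝ => (lam + m / Z₁) / (lam + m / Z)) (𝓝[>] 0)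
      (𝓝 ((0 + m / Z₁) / (0 + m / Z))) := by
    have h1 : Tendsto (fun lam : ℝ => lam + m / Z₁) (𝓝[>] 0) (𝓝 (0 + m / Z₁)) :=
      (tendsto_id.add tendsto_const_nhds).mono_left nhdsWithin_le_nhds
    have h2 : Tendsto (fun lam : ℝ => lam + m / Z) (𝓝[>] 0) (𝓝 (0 + m / Z)) :=
      (tendsto_id.add tendsto_const_nhds).mono_left nhdsWithin_le_nhds
    exact h1.div h2 hc
  have hm0 : m ≠ 0 := hm.ne'
  have hval : (0 + m / Z₁) / (0 + m / Z) = Z / Z₁ := by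
    rw [zero_add, zero_add, div_div_eq_mul_div, div_mul_eq_mul_div, div_right_comm,
      mul_div_cancel_left₀ _ hm0]
  rw [hval] at hlim
  refine le_of_tendsto hlim ?_
  filter_upwards [Ioo_mem_nhdsGT (zero_lt_one' ℝ)] with lam hlam
  exact h lam hlam.1 hlam.2

end Summit.NavierStokesRegularity.NavierStokesRegularity.Theorems.Nguyen2022

end
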